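import Literature.AlgebraicGeometry.GroupActions.FixedPointScheme
import HarnessLib

/-!
# The fixed-point scheme of a finite group of invertible order on a smooth `S`-scheme is smooth
# over `S` (Edixhoven 1992, Prop. 3.4 — any base scheme) — NAMED FACT + the family corollaries (proved)

Literature topic `AlgebraicGeometry/GroupActions`; companion of `FixedPointScheme.lean` (the
interface `IsFixedPointScheme`, the equivariant smooth proper families `IsEquivariantSmoothProperFamily`
= D2 of the cell `hodge-kum4`) and of `FixedPointSchemeSmooth.lean` (Conrad–Gabber–Prasad A.8.10(2)
as the named fact `ConradGabberPrasad2015_fixedPointScheme_smooth`, stated — as printed there — over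
an AFFINE NOETHERIAN base `Spec R`, with the proved corollary
`IsEquivariantSmoothProperFamily.smooth_fixedPointScheme` over `Spec R`).  Typed for the cross-ladder
literature layer of ladder HodgeAV, rung H3 (sub-home `lit-family`, tranche LT-H3 (b), algebraic
FAMILY FORM over an arbitrary base): Edixhoven's Prop. 3.4 has NO affineness and NO noetherian
hypothesis on the base, so the relative fixed-point scheme `𝒳^G → B` of an equivariant smooth proper
family is smooth over ANY base scheme `B` on which `|G|` is invertible
(`IsEquivariantSmoothProperFamily.smooth_fixedPointScheme_of_orderInvertibleOn`, PROVED from the fact).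
GRADE: REFEREED (Compositio Math. 81 (1992) 291–306).

## Source (read at the page: NUMDAM text `paper:url-c9c5b4bd0feb` = CM_1992__81_3_291_0, pp. 293–295)

B. Edixhoven, *Néron models and tame ramification*, Compositio Math. 81 (1992) 291–306
[`Edixhoven1992NeronModelsTame`], §3 "Generalities about fixed points", VERBATIM.  Setting (p0004
L3–L5): "Let `X → S` be a morphism of schemes, and let `G` be a finite group acting equivariantly on
`X → S`, with the trivial action on `S`. We define the functor `X^G` of fixed points by: [display]."
**Prop. 3.1** (p0004 L6–L8): "The functor `X^G` is represented by a subscheme of `X`. The formation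
of `X^G` commutes with base change on `S`. If `X → S` is separated, then `X^G` is a closed subscheme
of `X`."  **Lemma 3.3** (p0004 L27 – p0005 L3, formal linearisation): "Let `A` be a complete local
ring with residue field `k`, `d` a non-negative integer, `B = A[[T₁,…,T_d]]`. Let `G` be a finite
group acting on the `A`-algebra `B`, and let `n = #G`. Suppose that `A` is a `ℤ[1/n]`-algebra. Then
there exist `S₁,…,S_d ∈ B`, with `B = A[[S₁,…,S_d]]`, such that the `A`-submodule
`M = AS₁ ⊕ ⋯ ⊕ AS_d` is `G`-stable."  **Prop. 3.4** (p0005 L27–L28): "If the morphism `f : X → S`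
is smooth, and `n := #G` is invertible on `X`, then `X^G` is smooth over `S`."  (Proof, p0005 L29 –
p0006 L15: reduce to `S` noetherian by EGA IV 8.8.3/17.7.8, complete at a fixed point, linearise by
3.3, and identify the ideal of `X^G` with `Σ_{i>e} B·Tᵢ`, so that `𝒪̂_{X^G,x} ≅ A[[T₁,…,T_e]]` is
formally smooth.)  **Prop. 3.5** (p0006 L16–L19): "Let `G` be a finite group, acting equivariantly on
a smooth morphism of schemes `f : X → S`. If `#G` is invertible on `X`, then the induced morphism
`f : X^G → S^G` is smooth. *Proof.* Apply the preceding proposition to `X ×_S S^G → S^G`."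

## Rendering (tree carriers) and faithfulness

In the vocabulary of `FixedPointScheme.lean`: `X : Over S`, `ρ : G →* Aut X` (an action by
`S`-automorphisms = "acting equivariantly on `X → S` with the trivial action on `S`"),
`j : F ⟶ X` with `IsFixedPointScheme ρ j` (`F` represents Edixhoven's functor `X^G` AND `j` is a
closed immersion — so the record speaks about `X^G` exactly when it is a closed subscheme, e.g. for
`X → S` separated, Prop. 3.1; for other `X` it is vacuous, never false), `Smooth X.hom` (Mathlib),
"`#G` invertible on `X`" = `OrderInvertibleOn G X.left` (`|G|` a unit of `Γ(X, 𝒪_X)`, the tree's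
predicate).  Conclusion `Smooth F.hom`.  FAITHFUL (same hypotheses, same conclusion; ANY base `S`).
Prop. 3.1 is the tree's PROVED `fixedPointScheme.isFixedPointScheme` (finite `G`, separated `X`) and
`IsFixedPointScheme.baseChange`; Prop. 3.5 is not typed (`-- TODO(general form)`: actions moving the
base).  Relation to `ConradGabberPrasad2015_fixedPointScheme_smooth`: that record is the RELATIVE
statement (`Y → Y'` smooth equivariant ⇒ `Y^G → Y'^G` smooth) over `Spec R`, `R` noetherian; the
present one is the absolute statement over an arbitrary base — neither is a restatement of the
other; `smooth_of_isFixedPointScheme_of_isUnit` below shows the present record yields the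
"in particular" clause of A.8.10(2) WITHOUT the noetherian hypothesis.

## Contents (namespace `Literature.AlgebraicGeometry.GroupActions`)

* `OrderInvertibleOn.of_hom` (proved): `|G|` invertible on `B` ⇒ invertible on any `𝒳 → B`.
* NAMED FACT `Edixhoven1992_fixedPointScheme_smooth` (Prop. 3.4).
* PROVED corollaries: `smooth_of_isFixedPointScheme_of_orderInvertibleOn` (base form),
  `smooth_of_isFixedPointScheme_of_isUnit` (over `Spec R`, any commutative ring `R` with `|G| ∈ Rˣ`),
  `IsEquivariantSmoothProperFamily.smooth_fixedPointScheme_of_orderInvertibleOn` (**the family form: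
  `𝒳^G → B` is smooth for an equivariant smooth proper family over any base `B` with `|G|` invertible
  on `B`**), and `IsEquivariantSmoothProperFamily.smooth_fixedPointScheme_fibre` (hence every fibre
  `(𝒳^G)_b = (𝒳_b)^G → Spec κ(b)` is smooth — smoothness is stable under base change).

No instances, no notation, no `sorry`; exactly ONE new named fact.
-/

universe u v

open CategoryTheory CategoryTheory.Limits AlgebraicGeometry

namespace Literature.AlgebraicGeometry.GroupActions

/-! ## `|G|` invertible: permanence along morphisms -/

section Order

variable {G : Type*} [Finite G] {𝒳 B : Scheme.{u}}

/-- If `|G|` is invertible on `B` then it is invertible on every `B`-scheme `𝒳 → B` (apply the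
ring map `Γ(B, 𝒪_B) → Γ(𝒳, 𝒪_𝒳)`) [cite: Edixhoven1992NeronModelsTame, §3 Prop. 3.4]. -/
theorem OrderInvertibleOn.of_hom (π : 𝒳 ⟶ B) (h : OrderInvertibleOn G B) :
    OrderInvertibleOn G 𝒳 := by
  rw [orderInvertibleOn_iff] at h ⊢
  simpa using h.map π.appTop.hom

end Order

/-! ## Edixhoven 1992, Prop. 3.4 — the named fact -/

section Fact

/-- **Edixhoven 1992, Prop. 3.4 (NAMED FACT, REFEREED): the fixed-point scheme of a finite group
acting on a smooth `S`-scheme, of order invertible on it, is smooth over `S` — over ANY base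
scheme `S`.**  For a scheme `S`, a finite group `G` acting by `S`-automorphisms `ρ` on `X : Over S`,
and a fixed-point scheme `j : F ⟶ X` (`IsFixedPointScheme ρ j`: `F` represents the functor `X^G`
and `j` is a closed immersion): if `X → S` is smooth and `|G|` is invertible on `X`
(`OrderInvertibleOn G X.left`), then `F → S` is smooth.  "If the morphism `f : X → S` is smooth,
and `n := #G` is invertible on `X`, then `X^G` is smooth over `S`."  Not proved here (formal
linearisation, Lemma 3.3 ibid.).  TODO(general form): Prop. 3.5 (actions moving the base,
`X^G → S^G` smooth). [cite: Edixhoven1992NeronModelsTame, §3 Prop. 3.4] -/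
def Edixhoven1992_fixedPointScheme_smooth : Prop :=
  ∀ (S : Scheme.{u}) (G : Type v) [Group G] [Finite G] (X F : Over S) (ρ : G →* Aut X)
    (j : F ⟶ X), IsFixedPointScheme ρ j → Smooth X.hom → OrderInvertibleOn G X.left → Smooth F.hom

end Fact

/-! ## Proved corollaries -/

section Corollaries

variable {S : Scheme.{u}} {G : Type v} [Group G] [Finite G]

/-- Base form of the fact with instance arguments [cite: Edixhoven1992NeronModelsTame, §3 Prop. 3.4]. -/
theorem smooth_of_isFixedPointScheme_of_orderInvertibleOn
    (h : Edixhoven1992_fixedPointScheme_smooth.{u, v}) {X F : Over S} {ρ : G →* Aut X} {j : F ⟶ X}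
    (hF : IsFixedPointScheme ρ j) [Smooth X.hom] (hG : OrderInvertibleOn G X.left) : Smooth F.hom :=
  h S G X F ρ j hF ‹_› hG

/-- If `|G|` is invertible on the BASE `S`, the fixed-point scheme of a smooth `X → S` is smooth over
`S` [cite: Edixhoven1992NeronModelsTame, §3 Prop. 3.4]. -/
theorem smooth_of_isFixedPointScheme_of_orderInvertibleOn_base
    (h : Edixhoven1992_fixedPointScheme_smooth.{u, v}) {X F : Over S} {ρ : G →* Aut X} {j : F ⟶ X}
    (hF : IsFixedPointScheme ρ j) [Smooth X.hom] (hG : OrderInvertibleOn G S) : Smooth F.hom :=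
  smooth_of_isFixedPointScheme_of_orderInvertibleOn h hF (OrderInvertibleOn.of_hom X.hom hG)

/-- **«In particular, if `Y` is smooth then `Y^G` is smooth» over `Spec R` for ANY commutative ring
`R` with `|G| ∈ Rˣ`** (the "in particular" clause of Conrad–Gabber–Prasad A.8.10(2), here WITHOUT
the noetherian hypothesis) [cite: Edixhoven1992NeronModelsTame, §3 Prop. 3.4]. -/
theorem smooth_of_isFixedPointScheme_of_isUnit (h : Edixhoven1992_fixedPointScheme_smooth.{u, v})
    {R : Type u} [CommRing R] (hG : IsUnit ((Nat.card G : ℕ) : R))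
    {Y F : Over (Spec (CommRingCat.of R))} {ρ : G →* Aut Y} {j : F ⟶ Y}
    (hF : IsFixedPointScheme ρ j) [Smooth Y.hom] : Smooth F.hom := by
  refine smooth_of_isFixedPointScheme_of_orderInvertibleOn_base h hF ?_
  rw [orderInvertibleOn_iff]
  simpa using hG.map (Scheme.ΓSpecIso (CommRingCat.of R)).inv.hom

variable {𝒳 B : Scheme.{u}} {π : 𝒳 ⟶ B} {ρ : G →* Aut 𝒳}

/-- **The family form: the relative fixed-point scheme `𝒳^G → B` of an equivariant smooth proper
family is smooth, over ANY base scheme `B` on which `|G|` is invertible** (D2 of the cell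
`hodge-kum4` over a general base; over `Spec R`, `R` noetherian, this is
`IsEquivariantSmoothProperFamily.smooth_fixedPointScheme` from the Conrad–Gabber–Prasad record)
[cite: Edixhoven1992NeronModelsTame, §3 Prop. 3.4]. -/
theorem IsEquivariantSmoothProperFamily.smooth_fixedPointScheme_of_orderInvertibleOn
    (h : Edixhoven1992_fixedPointScheme_smooth.{u, v}) (hπ : IsEquivariantSmoothProperFamily π ρ)
    (hG : OrderInvertibleOn G B) : Smooth hπ.fixedPointScheme.hom :=
  have : Smooth (Over.mk π).hom := hπ.smooth
  smooth_of_isFixedPointScheme_of_orderInvertibleOn_base h hπ.isFixedPointScheme hG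

/-- … hence every FIBRE `(𝒳^G)_b → Spec κ(b)` — which is the fixed-point scheme of the action on
the fibre `𝒳_b`, `IsEquivariantSmoothProperFamily.isFixedPointScheme_fibre` — is smooth (base
change) [cite: Edixhoven1992NeronModelsTame, §3 Prop. 3.4 and Prop. 3.1]. -/
theorem IsEquivariantSmoothProperFamily.smooth_fixedPointScheme_fibre
    (h : Edixhoven1992_fixedPointScheme_smooth.{u, v}) (hπ : IsEquivariantSmoothProperFamily π ρ)
    (hG : OrderInvertibleOn G B) (b : B) :
    Smooth ((Over.pullback (B.fromSpecResidueField b)).obj hπ.fixedPointScheme).hom := by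
  have := hπ.smooth_fixedPointScheme_of_orderInvertibleOn h hG
  change Smooth (pullback.snd hπ.fixedPointScheme.hom (B.fromSpecResidueField b))
  infer_instance

end Corollaries

end Literature.AlgebraicGeometry.GroupActions
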